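import Mathlib
import Summits.NavierStokesRegularity.NavierStokesRegularity.Theses.SymmetryModuliCount
import Literature.Analysis.FluidPDE.TypeIAncientMild
import Literature.Analysis.FluidPDE.OseenSlice
import Literature.Analysis.FluidPDE.KNSSTypeIRateLiouvilleHolds
import Literature.Analysis.FluidPDE.OseenMildUniqueness
import HarnessLib

/-!
# Route SymmetryModuliCount — crux `HelicalEndLiouville` (stmt-NavierStokesRegularity-14062):
# proof skeleton of the line `vanishing-cell-reynolds` (far-past cell extinction)

The crux: a Type-I ancient mild field `u ∈ A_C` (`IsTypeIAncientMild C u`, KNSS/Oseen gauge)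
annihilated on a backward end `t < θ ≤ 0` by a Killing generator `(a + Ax)·∇ − A` with `A` skew
and `a ∉ range A` (a translation, or a screw motion of nonzero pitch) vanishes on that end.

Line (idea card `Cruxes/HelicalEndLiouville/Ideas/vanishing-cell-reynolds.md`, merged gap line of
the three triage panels):

1. `stub_helicalScrewPeriod` — screw ⊃ lattice: the symmetry makes every slice `L`-periodic for a
   fixed `L ≠ 0` (`L = a` if `A = 0`, else one full turn of the screw, `L = (2π/ρ)P_{ker A} a`).
2. `stub_cellGaps` — the Poincaré gap of the period cell in sup norm: for `L`-periodic bounded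
   continuous data the cell oscillation `(I − Π₀)` (`Π₀ f (x) = ∫₀¹ f (x + rL) dr`) of the heat
   flow is `≤ κ ‖L‖² σ⁻¹ M` and of one Oseen slice `N_σ[f,g]` is
   `≤ κ min(σ^{-1/2}, ‖L‖² σ^{-3/2}) M_f M_g` (Wirtinger in sup norm + the tree's derivative bounds
   `exists_norm_iteratedFDeriv_heatExtension_le`, `exists_norm_iteratedFDeriv_oseenSlice_le`).
3. `stub_cellOscRepr` — the cell oscillation of `u(t)` through the Oseen identity from time `s`
   (mild identity at `x` and at `x + rL`, Fubini on `[0,1] × (s,t)`).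
4. `stub_cellOscSlice` — oscillation of the quadratic slice `N_σ[f,f]` is linear in the
   oscillation of `f`: `≤ K min(…) · ‖f‖_∞ · ‖(I−Π₀)f‖_∞` (the mean cannot force the oscillation:
   `(I − Π₀)N_σ[Π₀f, Π₀f] = 0`).
5. `stub_cellAbsorption` — absorption on a far end: the kernel mass `∫ min = 4‖L‖` against the
   Type-I coefficient `C/√(−t)` (cell Reynolds number `C‖L‖/√(−t) → 0`) halves any uniform bound
   of the oscillation on `t < min θ (−(8KC‖L‖)²)`, so the oscillation is extinct there and `u` is
   invariant under ALL translations along `L`.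
6. `stub_lineLiouvilleEnd` — the 2.5-D leaf on an end: PROVED tree theorem
   `KNSS2009_typeI_rate_liouville_holds` after a rotation `L ↦ ‖L‖e₂` (rotation covariance of
   `A_C`) and a time shift (`IsTypeIAncientMild.comp_sub_right`).
7. `stub_forwardVanishing` — vanishing on a backward end propagates forward (= route support item
   stmt-14064 verbatim; `oseenMild_bounded_unique`).

`symmetryModuliCount_helicalEndLiouville_proof` composes 1–7 into the route decl BY NAME.
-/

noncomputable section

-- the summit and its single sub-problem share the name (CONVENTIONS §1), as in every Theorems file
set_option linter.dupNamespace false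

open Set MeasureTheory Function Filter
open Literature.Analysis.FluidPDE
open Literature.Analysis.UnboundedOperators (heatExtension)
open scoped RealInnerProductSpace Topology

namespace Summit.NavierStokesRegularity.NavierStokesRegularity.Theorems

local notation "E3" => EuclideanSpace ℝ (Fin 3)

/-- **Stub 1 (screw ⊃ lattice).** For a skew `A` on `ℝ³` and `a ∉ range A` there is ONE vector
`L ≠ 0` such that every differentiable field annihilated by the Killing generator
`(a + Ax)·∇ − A` is `L`-periodic (`L = a` if `A = 0`; otherwise `A³ = −ρ²A`, Rodrigues' formula
for the screw flow, one full turn `2π/ρ` is the translation by `L = (2π/ρ)(a + ρ⁻²A²a) ∈ ker A`,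
and `u ∘ Φ_s − e^{sA}u` solves `w' = Aw`, `w(0) = 0`, with `A` skew). [folklore] -/
theorem stub_helicalScrewPeriod :
    ∀ (a : E3) (A : E3 →L[ℝ] E3), (∀ x, inner ℝ (A x) x = 0) → a ∉ Set.range A →
      ∃ L : E3, L ≠ 0 ∧ ∀ (f : E3 → E3), Differentiable ℝ f →
        (∀ x, fderiv ℝ f x (a + A x) - A (f x) = 0) → ∀ x, f (x + L) = f x := by
  sorry

/-- **Stub 2 (cell gaps in sup norm).** One absolute `κ > 0` such that for `L`-periodic bounded
continuous data (i) the cell oscillation of the heat flow is `≤ κ ‖L‖² σ⁻¹ M` and (ii) the cell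
oscillation of one Oseen slice `N_σ[f, g]` is `≤ κ · min(σ^{-1/2}, ‖L‖² σ^{-3/2}) · M_f M_g`
(Wirtinger in sup norm for an `L`-periodic `C²` function, `‖h − Π₀h‖_∞ ≤ ‖L‖² ‖D²h‖_∞`, and the
tree bounds `‖D² e^{σΔ}g‖ ≤ A₂σ⁻¹‖g‖_∞`, `‖N_σ‖ ≤ C₀σ^{-1/2}M_fM_g`, `‖D²N_σ‖ ≤ C₂σ^{-3/2}M_fM_g`). [folklore] -/
theorem stub_cellGaps :
    ∃ κ : ℝ, 0 < κ ∧
      (∀ (L : E3) (g : E3 → E3) (M σ : ℝ), Continuous g → (∀ x, g (x + L) = g x) →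
        (∀ x, ‖g x‖ ≤ M) → 0 < σ → ∀ x : E3,
          ‖heatExtension g σ x - ∫ r in (0:ℝ)..1, heatExtension g σ (x + r • L)‖ ≤
            κ * (‖L‖ ^ 2 / σ) * M) ∧
      (∀ (L : E3) (f g : E3 → E3) (Mf Mg σ : ℝ), Continuous f → Continuous g →
        (∀ x, f (x + L) = f x) → (∀ x, g (x + L) = g x) → (∀ x, ‖f x‖ ≤ Mf) →
        (∀ x, ‖g x‖ ≤ Mg) → 0 < σ → ∀ x : E3,
          ‖oseenSlice σ f g x - ∫ r in (0:ℝ)..1, oseenSlice σ f g (x + r • L)‖ ≤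
            κ * min (σ ^ (-(1 / 2 : ℝ))) (‖L‖ ^ 2 * σ ^ (-(3 / 2 : ℝ))) * Mf * Mg) := by
  sorry

/-- **Stub 3 (representation of the cell oscillation).** For `u ∈ A_C`, `s < t < 0` and any `L`:
the cell oscillation of `u(t)` equals that of the free term `e^{(t−s)Δ}u(s)` minus the time
integral of the cell oscillations of the Oseen slices `N_{t−τ}[u(τ), u(τ)]` (the mild identity
`IsTypeIAncientMild.mild_eq_heatExtension` at `x` and at `x + rL`, Fubini on `[0,1] × (s,t)` under
the envelope `C₀(t−τ)^{-1/2}C²/(−t)`). [folklore] -/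
theorem stub_cellOscRepr :
    ∀ (C : ℝ) (u : ℝ → E3 → E3), IsTypeIAncientMild C u → ∀ (L : E3) (s t : ℝ), s < t → t < 0 →
      ∀ x : E3,
        u t x - (∫ r in (0:ℝ)..1, u t (x + r • L)) =
          (heatExtension (u s) (t - s) x - ∫ r in (0:ℝ)..1, heatExtension (u s) (t - s) (x + r • L)) -
          ∫ τ in Set.Ioo s t, (oseenSlice (t - τ) (u τ) (u τ) x -
            ∫ r in (0:ℝ)..1, oseenSlice (t - τ) (u τ) (u τ) (x + r • L)) := by
  sorry

/-- **Stub 4 (the mean cannot force the oscillation).** Given the Oseen cell gap with constant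
`κ`, the cell oscillation of the quadratic slice `N_σ[f, f]` of an `L`-periodic bounded continuous
`f` is bounded LINEARLY in the oscillation `S = ‖(I − Π₀)f‖_∞`:
`≤ K · min(σ^{-1/2}, ‖L‖²σ^{-3/2}) · M · S` (`N[f,f] − N[m,m] = N[f−m, f] + N[m, f−m]` with
`m = Π₀f` invariant under all translations along `L`, so `(I − Π₀)N[m,m] = 0`). [folklore] -/
theorem stub_cellOscSlice :
    ∀ κ : ℝ,
      (∀ (L : E3) (f g : E3 → E3) (Mf Mg σ : ℝ), Continuous f → Continuous g →
        (∀ x, f (x + L) = f x) → (∀ x, g (x + L) = g x) → (∀ x, ‖f x‖ ≤ Mf) →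
        (∀ x, ‖g x‖ ≤ Mg) → 0 < σ → ∀ x : E3,
          ‖oseenSlice σ f g x - ∫ r in (0:ℝ)..1, oseenSlice σ f g (x + r • L)‖ ≤
            κ * min (σ ^ (-(1 / 2 : ℝ))) (‖L‖ ^ 2 * σ ^ (-(3 / 2 : ℝ))) * Mf * Mg) →
      ∃ K : ℝ, 0 < K ∧ ∀ (L : E3) (f : E3 → E3) (M S σ : ℝ), Continuous f →
        (∀ x, f (x + L) = f x) → (∀ x, ‖f x‖ ≤ M) →
        (∀ x, ‖f x - ∫ r in (0:ℝ)..1, f (x + r • L)‖ ≤ S) → 0 < σ → ∀ x : E3,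
          ‖oseenSlice σ f f x - ∫ r in (0:ℝ)..1, oseenSlice σ f f (x + r • L)‖ ≤
            K * min (σ ^ (-(1 / 2 : ℝ))) (‖L‖ ^ 2 * σ ^ (-(3 / 2 : ℝ))) * M * S := by
  sorry

/-- **Stub 5 (far-past cell extinction by absorption).** Given the heat cell gap (constant `κ`),
the representation of stub 3 and the slice bound of stub 4 (constant `K`): an `L`-periodic
(`L ≠ 0`) element of `A_C` on an end `t < θ ≤ 0` is invariant under ALL translations along `L`
on the far end `t < min θ (−(8KC‖L‖)²)` — any uniform bound `B` of the oscillation there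
improves to `B/2` (free term `→ 0` as `s → −∞`; kernel mass `∫₀^∞ min(σ^{-1/2}, ‖L‖²σ^{-3/2}) dσ
= 4‖L‖` against the coefficient `C/√(−t)`), so the oscillation vanishes and
`u(t) = Π₀u(t)` is translation invariant along `L`. [folklore] -/
theorem stub_cellAbsorption :
    ∀ κ K : ℝ,
      (∀ (L : E3) (g : E3 → E3) (M σ : ℝ), Continuous g → (∀ x, g (x + L) = g x) →
        (∀ x, ‖g x‖ ≤ M) → 0 < σ → ∀ x : E3,
          ‖heatExtension g σ x - ∫ r in (0:ℝ)..1, heatExtension g σ (x + r • L)‖ ≤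
            κ * (‖L‖ ^ 2 / σ) * M) →
      (∀ (C : ℝ) (u : ℝ → E3 → E3), IsTypeIAncientMild C u → ∀ (L : E3) (s t : ℝ), s < t → t < 0 →
        ∀ x : E3,
          u t x - (∫ r in (0:ℝ)..1, u t (x + r • L)) =
            (heatExtension (u s) (t - s) x -
              ∫ r in (0:ℝ)..1, heatExtension (u s) (t - s) (x + r • L)) -
            ∫ τ in Set.Ioo s t, (oseenSlice (t - τ) (u τ) (u τ) x -
              ∫ r in (0:ℝ)..1, oseenSlice (t - τ) (u τ) (u τ) (x + r • L))) →
      (∀ (L : E3) (f : E3 → E3) (M S σ : ℝ), Continuous f →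
        (∀ x, f (x + L) = f x) → (∀ x, ‖f x‖ ≤ M) →
        (∀ x, ‖f x - ∫ r in (0:ℝ)..1, f (x + r • L)‖ ≤ S) → 0 < σ → ∀ x : E3,
          ‖oseenSlice σ f f x - ∫ r in (0:ℝ)..1, oseenSlice σ f f (x + r • L)‖ ≤
            K * min (σ ^ (-(1 / 2 : ℝ))) (‖L‖ ^ 2 * σ ^ (-(3 / 2 : ℝ))) * M * S) →
      ∀ (C : ℝ) (u : ℝ → E3 → E3), IsTypeIAncientMild C u → ∀ (L : E3) (θ : ℝ), L ≠ 0 → θ ≤ 0 →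
        (∀ t < θ, ∀ x, u t (x + L) = u t x) →
        ∀ t < θ, t < -(8 * K * C * ‖L‖) ^ 2 → ∀ (x : E3) (s : ℝ), u t (x + s • L) = u t x := by
  sorry

/-- **Stub 6 (the 2.5-D leaf on an end, direction-free).** An element of `A_C` invariant under
all translations along a line `ℝL` (`L ≠ 0`) on a backward end `t < T ≤ 0` vanishes on that end:
rotate `L` onto `‖L‖e₂` (rotation covariance of `A_C`: `K(τ, Rz)[Ra, Rb] = R K(τ, z)[a, b]`,
`e^{σΔ}` commutes with isometries), shift time by `σ > 0` to make the field bounded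
(`IsTypeIAncientMild.comp_sub_right`), and apply the PROVED tree theorem
`KNSS2009_typeI_rate_liouville_holds` (KNSS 2009, proof of Thm 6.2 with Thm 5.1). [cite: KochNadirashviliSereginSverak2009, proof of Thm 6.2 (arXiv:0709.3599 p. 13)] -/
theorem stub_lineLiouvilleEnd :
    ∀ (C : ℝ) (u : ℝ → E3 → E3), IsTypeIAncientMild C u → ∀ (L : E3) (T : ℝ), L ≠ 0 → T ≤ 0 →
      (∀ t < T, ∀ (x : E3) (s : ℝ), u t (x + s • L) = u t x) → ∀ t < T, ∀ x, u t x = 0 := by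
  sorry

/-- **Stub 7 (vanishing on a backward end propagates forward)** — the route's support item
`BackwardEndVanishing` (stmt-NavierStokesRegularity-14064) verbatim: forward uniqueness of
bounded Oseen-mild fields (`oseenMild_bounded_unique`) on the windows `(θ − 1, t')`, `t' < 0`,
against the comparison field `0` (free term `e^{σΔ}0 = 0`). [cite: KochNadirashviliSereginSverak2009, §4 (4.3)–(4.4) (arXiv:0709.3599 p. 8)] -/
theorem stub_forwardVanishing :
    ∀ (C : ℝ) (u : ℝ → E3 → E3), IsTypeIAncientMild C u → ∀ θ : ℝ, θ ≤ 0 →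
      (∀ t < θ, ∀ x, u t x = 0) → ∀ t < 0, ∀ x, u t x = 0 := by
  sorry

/-- **The crux `HelicalEndLiouville` (stmt-NavierStokesRegularity-14062), composed from the seven
stubs of the line `vanishing-cell-reynolds`**: period (1) ⇒ far-past extinction of the cell
oscillation (2–5) ⇒ the 2.5-D leaf kills `u` on the far end (6) ⇒ forward vanishing up to `θ`
(7). [folklore] -/
theorem symmetryModuliCount_helicalEndLiouville_proof :
    Summit.NavierStokesRegularity.NavierStokesRegularity.Theses.SymmetryModuliCount.HelicalEndLiouville := by
  intro C u hu a A θ hA ha hθ hsym t ht x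
  -- stub 1: one period `L ≠ 0` for every slice on the end
  obtain ⟨L, hL0, hper⟩ := stub_helicalScrewPeriod a A hA ha
  have hperu : ∀ τ < θ, ∀ y, u τ (y + L) = u τ y := fun τ hτ y =>
    hper (u τ) ((hu.contDiff_slice (lt_of_lt_of_le hτ hθ)).differentiable (by simp)) (hsym τ hτ) y
  -- stubs 2–5: the cell oscillation is extinct on a far end
  obtain ⟨κ, _hκ, hheat, hoseen⟩ := stub_cellGaps
  obtain ⟨K, _hK, hslice⟩ := stub_cellOscSlice κ hoseen
  have hext := stub_cellAbsorption κ K hheat stub_cellOscRepr hslice C u hu L θ hL0 hθ hperu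
  set T : ℝ := min θ (-(8 * K * C * ‖L‖) ^ 2) with hT
  have hTθ : T ≤ θ := min_le_left _ _
  have hT0 : T ≤ 0 := hTθ.trans hθ
  have hinv : ∀ τ < T, ∀ (y : E3) (s : ℝ), u τ (y + s • L) = u τ y := fun τ hτ y s =>
    hext τ (lt_of_lt_of_le hτ hTθ) (lt_of_lt_of_le hτ (min_le_right _ _)) y s
  -- stub 6: the 2.5-D leaf on the far end; stub 7: forward vanishing up to `θ`
  have hzero : ∀ τ < T, ∀ y, u τ y = 0 := stub_lineLiouvilleEnd C u hu L T hL0 hT0 hinv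
  exact stub_forwardVanishing C u hu T hT0 hzero t (lt_of_lt_of_le ht hθ) x

end Summit.NavierStokesRegularity.NavierStokesRegularity.Theorems

end
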